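import Literature.AlgebraicGeometry.HodgeTheory.WeilClassesCyclicPrym
import HarnessLib

/-!
# Schoen's cyclic Prym fact in prime degree `7` over genus `7` (`g(C) = 43`, `h = 12`)

Topic `AlgebraicGeometry/HodgeTheory`; namespace `Literature.AlgebraicGeometry.HodgeTheory`.
The degree-`7` sibling of the named facts
`Schoen1988_cyclicPrym_weilClasses_algebraic_degreeSix` / `…_degreeThree`
(`WeilClassesCyclicPrym.lean`): C. Schoen, Compositio Math. 65 (1988), Cor. 3.1 (p. 24) with
Thm. 2.0 (p. 11) and Lemma 1.5, at `(q, m, r) = (7, 7, 0)` = D. Patel–Y. Zhang, arXiv:2506.13729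
(2025), Thm. 1.2 (p. 3) / Thm. 5.3 with Lemma 5.1 (p. 12) at `G = ℤ/7`, `g(C') = 7`, `h = 12`:
for an étale cyclic cover `C → C'` of PRIME degree `7` of a genus-`7` curve (`g(C) = 43`), on the
Prym `B = (ker Nm)⁰ = (ker Σ_{i<7} σ_*ⁱ)⁰ ⊂ J(C)` (an abelian `36`-fold with `ℚ(μ₇) ⊂ End⁰ B`)
the Hodge substructure `U_Weil = U_prim = ⋀¹²_{ℚ(μ₇)} H¹(B, ℚ) ⊂ H¹²(B, ℚ)` — six-dimensional,
`U_Weil ⊗ ℂ = ⊕_{a=1}^{6} ⋀¹² H¹(B; ℂ)_{ζ₇^a}` — is generated by classes of algebraic cycles of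
codimension `6`.

* `Schoen1988_cyclicPrym_weilClasses_algebraic_degreeSeven` — the NAMED FACT (a `def … : Prop`,
  not proved here), on the tree's carriers, each of the six isotypic lines typed as ONE eigenspace
  of the single pull-back `(2·𝟙_B + s_B)^*` on `H¹²(B(ℂ); ℂ)` (TYPING paragraph of its docstring).
  Consumer: crux `HeckePrymWeil.WeilTwelvefoldsSqrtMinus7` (stmt-HodgeConjecture-1261), line
  `isotypic-unimodular-saturation`, stub `stub_schoenLines` (whose registered signature is this
  statement verbatim): the Hecke–Prym twelvefold of an `F₂₁`-étale cover of a genus-`3` curve is the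
  `μ₃`-coinvariant quotient of this `B`, and its typed `ℚ(√-7)`-Weil plane is one restriction of
  these six lines.
* The ENDOMORPHISM DICTIONARY of the rendering, proved unconditionally (no cohomology): in any
  preadditive category, `Φ₇(t) := 𝟙 + t + ⋯ + t⁶ = 0 ⟹ t⁷ = 𝟙` and the quadratic GAUSS SUM
  `η := t + t² + t⁴ - t³ - t⁵ - t⁶` has `η ∘ η = -7` (`ℤ[η] ≅ ℤ[√-7] ⊂ ℤ[ζ₇]`); for
  `t⁷ = 𝟙` the norm element `e = Σ_{i<7} tⁱ` has `t ∘ e = e`, `(𝟙 - t) ∘ e = 0`, `e ∘ e = 7e`; for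
  the tree's `B = AbelianVariety.kerComponent e_N`, `e_N = Σ_{i<7} sⁱ`, and a restriction `s_B` of
  `s` (`s_B ≫ ι = ι ≫ s`): `Φ₇(s_B) = 0`, `s_B⁷ = 𝟙_B`, `η_B ≫ η_B = -7·𝟙_B`; and
  `(σ_*)⁷ = 𝟙_{J(C)}` for `σ⁷ = 𝟙_C` (`Jacobian.pushforward`); finally, in any category, an
  endomorphism `σ` with `σ⁷ = 𝟙` that moves a point moves it by every `σⁱ`, `1 ≤ i ≤ 6` (prime
  order: `⟨σⁱ⟩ = ⟨σ⟩`), so "`σ` fixed-point free" already says that `⟨σ⟩ ≅ ℤ/7` acts freely.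

What is NOT here: the cohomological half of the dictionary (`H¹²(B(ℂ); ℂ) = ⋀¹² H¹`,
`Motives.abelianVarietyCohomologyExteriorH1`; Chevalley–Weil multiplicities `12`; `dim B = 36`) and
any part of Schoen's proof (symmetric powers, the Abel–Jacobi `ℙ⁶`-bundle, the class-field-theory
square, Lieberman) — exactly as for the degree-`6`/`3` siblings and their companions
`WeilClassesCyclicPrymTyping/Dimension/Lefschetz/OneClass/DegreeThree`.

## References

* [Schoen1988HodgeWeil] C. Schoen, *Hodge classes on self-products of a variety with an
  automorphism*, Compositio Math. 65 (1988) 3–32: Lemma 1.5 (p. 7), Lemma 1.6a (p. 8), Thm. 2.0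
  (p. 11; "the simplicity hypothesis is automatically satisfied if `r = 0`", p. 12; proof for
  `r = 0`, p. 13), §3 (p. 24: `B = Im P`, `P = Σ_{t ∈ ℤ/m}(Id - t)` for `m` prime) and Cor. 3.1
  (p. 24). Read on Numdam.
* [PatelZhang2025PrymHodge] D. Patel, Y. Zhang, arXiv:2506.13729 (2025): Thm. 1.2 (p. 3), Lemma 2.9,
  Cor. 2.10 and §2.6 (p. 7), Thm. 4.4 (pp. 10–11), §5 eqn. (Prym-image), Lemma 5.1, Def. 5.2,
  Thm. 5.3 (p. 12). Held: `paper:arxiv-2506.13729`.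
* [Lange2023AbelianVarietiesC] H. Lange, *Abelian Varieties over the Complex Numbers* (2023), §4.5.2.
-/

namespace Literature.AlgebraicGeometry.HodgeTheory

open CategoryTheory
open Literature.AlgebraicGeometry Literature.AlgebraicGeometry.Motives

/-- **Schoen's cyclic theorem, prime degree `7` over genus `7` (Schoen 1988, Cor. 3.1 with Thm. 2.0
and Lemma 1.5 at `(q, m, r) = (7, 7, 0)` = Patel–Zhang 2025, Thm. 1.2 / Thm. 5.3 with Lemma 5.1 at
`G = ℤ/7`, `g(C') = 7`), on the tree's carriers.**  PRINTED STATEMENT (PZ Thm. 1.2, p. 3, with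
§1.2, §2.6, p. 7, and §5, p. 12): for an étale cover `C → C'` of smooth projective complex curves
with finite abelian Galois group `G`, `g(C') ≥ 2`, `h := 2g(C') - 2`, the Prym
`B := (ker (Nm : J(C) → J(C')))⁰` (§2.6 eqn. (Prym); for `G = ℤ/m` also `B = Im(1 - σ)`, §5) has
`H¹(B, ℚ) = H¹(C, ℚ)_{nt}` free of rank `h` over `ℚ[G]_{nt}` (Cor. 2.10: every non-trivial
character occurs with multiplicity `h`, Lemma 2.9; Lemma 5.1: `dim B = (m-1)(g(C')-1)`, `σ_B` of
order `m` with every eigenvalue `exp(2πik/m)`, `1 ≤ k ≤ m-1`, of multiplicity `g(C')-1` on `T₀B`),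
and `U_Weil := ⋀^h_{ℚ[G]_{nt}} H¹(B, ℚ) ⊂ H^h(B, ℚ)` — `|G|-1`-dimensional, consisting of Hodge
classes, `U_Weil ⊗ ℂ` having the basis `v₁ ∧ ⋯ ∧ v_h`, `vᵢ` a basis of the `χ`-isotypic part
`H¹_χ`, `χ ≠ 0` (§2.6) — "are represented by algebraic cycles" (Thm. 1.2); for `m` prime
`H¹(B, ℚ)` is free over `ℚ(μ_m)`, `B = B_prim` is Schoen's Prym and `U_Weil = U_prim :=
⋀^h_{ℚ(μ_m)} H¹(B_prim, ℚ)`, and Thm. 5.3 "(Schoen88). `U_prim` is generated by algebraic cycles";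
in the original: Schoen 1988, Cor. 3.1 (p. 24: "If `(C, σ)` satisfies the hypotheses of (2.0), then
`U' ⊂ H^h(B, ℚ)` is generated by fundamental classes of codimension `h/2` algebraic cycles"), where
`B = Im P ⊂ Alb(C)`, `P = Σ_{t ∈ ℤ/m}(Id - t)` for `m` prime (§3, p. 24), `h = -e(C/σ) = 2q - 2`
for a free action (Lemma 1.5), and the simplicity hypothesis of Thm. 2.0 (p. 11) "is automatically
satisfied if `r = 0`" (p. 12).  No genericity hypothesis on the cover.
RENDERING (the instance `m = 7`, `g(C) = 43`; dictionary steps marked; the binder shape of the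
degree-`6`/`3` siblings with `Φ₇` in place of `Φ₆`/`Φ₃`): `C` is a smooth projective complex curve
with a Jacobian `𝒥` (`Motives.Jacobian`, Albanese property) of dimension `43` (= `g(C)`, Milne
Prop. 2.1; `C` is then non-empty and connected) and an automorphism `σ` with `σ⁷ = 𝟙` and no fixed
complex point — so `σ ≠ 𝟙` has prime order `7` and EVERY `σⁱ`, `1 ≤ i ≤ 6`, is fixed-point free
(`⟨σⁱ⟩ = ⟨σ⟩`; `comp_pow_ne_of_comp_ne_of_pow_seven`): `⟨σ⟩ ≅ ℤ/7` acts freely,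
`C → C' := C/⟨σ⟩` is étale cyclic of degree `7` (`r = 0`), and by Riemann–Hurwitz
`84 = 2·43 - 2 = 7·(2g(C') - 2)`, i.e. `g(C') = q = 7 ≥ 2`, `h = 12` (even, as Thm. 2.0 wants);
`s := σ_*` (`Jacobian.pushforward`; `s⁷ = 𝟙`, `pushforward_comp_pow_seven_of_pow_seven`),
`e_N := 𝟙 + s + ⋯ + s⁶ = π^* ∘ Nm_π` (`s ∘ e_N = e_N`, `e_N² = 7 e_N`; `ker π^*` is finite), and
`B := (ker e_N)⁰ = (ker Nm)⁰` (`AbelianVariety.kerComponent e_N`) — PZ's Prym `J(C)_{nt}` and, `7`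
being prime, Schoen's `B = Im(7·Id - e_N) = B_prim`: an abelian `36`-fold (`= 6·6 = h·φ(7)/2`) with
`H¹(B; ℂ) = ⊕_{a=1}^{6} H¹_{ζ₇^a}`, `12` each; `s_B` is the restriction of `s` to `B` (it exists:
`kerComponentRestrict`, as `s ∘ e_N = e_N ∘ s`), `Φ₇(s_B) = Σ_{i<7} s_Bⁱ = 0`
(`kerComponent_cyclotomic₇_restrict_eq_zero`: `ℤ[s_B] = ℤ[ζ₇] ⊂ End B`, "`B` has the correct sort
of multiplication from `K = ℚ(μ₇)`", Schoen §3), `s_B⁷ = 𝟙` (`kerComponent_restrict_comp_pow_seven`)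
and the Gauss sum `η_B = s_B + s_B² + s_B⁴ - s_B³ - s_B⁵ - s_B⁶` has `η_B² = -7`
(`kerComponent_weilOperator_comp_self_of_cyclotomic₇`: `ℚ(√-7) ⊂ ℚ(ζ₇)`).
TYPING (bookkeeping NOT in print): on `H¹²(B(ℂ); ℂ) = ⋀¹² H¹` (cup product, Lange–Birkenhake
1.1.17; `Motives.abelianVarietyCohomologyExteriorH1`) the pull-back `(2·𝟙_B + s_B)^*`
(`= ⋀¹²(2 + s_B^*|H¹)`, pull-back being additive on `H¹` and multiplicative) acts on the summand
`⊗_{b=1}^{6} ⋀^{k_b} H¹_{ζ₇^b}` (`Σ k_b = 12`) by `∏_b (2 + ζ₇^b)^{k_b}`, `ζ₇ = exp(2πi/7)`; since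
`N_{ℚ(ζ₇)/ℚ}(2 + ζ₇) = Φ₇(-2) = 43` is a prime `≡ 1 (mod 7)`, the six conjugates `2 + ζ₇^b` generate
six DISTINCT degree-one primes of `ℤ[ζ₇]` (`ζ₇ ↦ 41, 16, 11, 4, 35, 21 ∈ 𝔽₄₃`), so
`∏_b (2 + ζ₇^b)^{k_b} = (2 + ζ₇^a)¹²` iff the multi-index is pure (`k_a = 12`): for each
`1 ≤ a ≤ 6`, `Eig((2·𝟙_B + s_B)^*, (2 + ζ₇^a)¹²) = ⋀¹² H¹_{ζ₇^a}` EXACTLY — one of the six lines of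
`U_Weil ⊗ ℂ = U_prim ⊗ ℂ` (neither larger nor smaller; `(𝟙 + s_B)^*` would NOT separate them:
`1 + ζ₇⁶ = ζ₇⁶(1 + ζ₇)`, `(1+ζ₇)⁵(1+ζ₇⁶)⁷ = (1+ζ₇)¹²`), and "`U_Weil` is represented by algebraic
cycles" is "every class of each of the six eigenspaces lies in `algebraicClasses B.X 6`" (the
`ℂ`-span of the codimension-`6` cycle classes = the classes supported in codimension `6`,
`HodgeTheory.AlgebraicClasses`).
-- TODO(general form): PZ Thm 1.2 for all `n`, `g''` (and all abelian `G`), once the tree has the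
-- `χ`-isotypic decomposition of `H¹` of a `G`-abelian variety and `⋀^h_{ℚ[G]_nt}` on real carriers.
[cite: PatelZhang2025PrymHodge, Thm 1.2 (p. 3), §2.6 (p. 7), Lemma 5.1 and Thm 5.3 (p. 12)]
[cite: Schoen1988HodgeWeil, Cor 3.1 (p. 24) with Thm 2.0 (p. 11) and Lemma 1.5, at (q, m, r) = (7, 7, 0)]
[file AlgebraicGeometry/HodgeTheory/WeilClassesCyclicPrymDegreeSeven] -/
def Schoen1988_cyclicPrym_weilClasses_algebraic_degreeSeven : Prop :=
  ∀ (C : SchemeOver ℂ) (𝒥 : Jacobian C) (σ : C ⟶ C),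
    IsSmoothProjective 1 C → 𝒥.J.dim = 43 →
    σ ≫ σ ≫ σ ≫ σ ≫ σ ≫ σ ≫ σ = 𝟙 C → (∀ P : ComplexPoints C, P ≫ σ ≠ P) →
  ∀ (s eN : 𝒥.J ⟶ 𝒥.J), s = 𝒥.pushforward 𝒥 σ →
    eN = 𝟙 𝒥.J + s + s ≫ s + s ≫ s ≫ s + s ≫ s ≫ s ≫ s + s ≫ s ≫ s ≫ s ≫ s +
      s ≫ s ≫ s ≫ s ≫ s ≫ s →
  ∀ (sB : AbelianVariety.kerComponent eN ⟶ AbelianVariety.kerComponent eN),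
    sB ≫ AbelianVariety.kerComponentι eN = AbelianVariety.kerComponentι eN ≫ s →
  ∀ a : ℕ, 1 ≤ a → a ≤ 6 →
  ∀ c : complexBetti (AbelianVariety.kerComponent eN).X 12,
    c ∈ Module.End.eigenspace
        (complexBetti.map ((2 : ℤ) • 𝟙 (AbelianVariety.kerComponent eN) + sB).hom.hom.hom 12).hom
        ((2 + Complex.exp (2 * (Real.pi : ℂ) * Complex.I / 7) ^ a) ^ 12) →
    c ∈ algebraicClasses (AbelianVariety.kerComponent eN).X 6

/-! ### Dictionary lemmas: `Φ₇(t) = 0`, `t⁷ = 𝟙`, the norm element and the quadratic Gauss sum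

The RENDERING paragraph asserts, on the level of endomorphisms (before any cohomology is taken):
on `J`, `s⁷ = 𝟙` and the norm element `e_N = Σ_{i<7} sⁱ` is `s`-invariant with `e_N² = 7e_N`
(so `Im(𝟙 - s) ⊆ ker e_N`: PZ §5 eqn. (Prym-image), Schoen §3 `B = Im P`); on `B = (ker e_N)⁰`,
`Φ₇(s_B) = 0`, hence `s_B⁷ = 𝟙` and `ℤ[s_B]` is a quotient of `ℤ[ζ₇]`, containing the Gauss sum
`η_B = Σ_{a ∈ (ℤ/7)ˣ} (a/7) s_Bᵃ` with `η_B² = (-1/7)·7 = -7`.  All of this is proved here in any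
preadditive category (resp. for the tree's `AbelianVariety.kerComponent`, `Jacobian.pushforward`).
The scalar shadow `(ζ₇ + ζ₇² + ζ₇⁴ - ζ₇³ - ζ₇⁵ - ζ₇⁶)² = -7` has the certificate
`g(X)² + 7 = (X⁵ + 2X⁴ - X³ + X - 6)(X⁷ - 1) + Φ₇(X)`; in the group ring,
`g(t)² = -6·𝟙 + (t + t² + ⋯ + t⁶) = -7·𝟙 + Φ₇(t)`. -/

section CyclotomicSeven

variable {𝒞 : Type*} [Category 𝒞] [Preadditive 𝒞] {X : 𝒞} {t : X ⟶ X}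

/-- If `Φ₇(t) = 𝟙 + t + ⋯ + t⁶ = 0` then `t⁷ = 𝟙` (`X⁷ - 1 = (X - 1)Φ₇(X)`): `t` generates an
action of `ℤ/7`. [folklore] -/
theorem comp_pow_seven_eq_id_of_cyclotomic₇
    (h : 𝟙 X + t + t ≫ t + t ≫ t ≫ t + t ≫ t ≫ t ≫ t + t ≫ t ≫ t ≫ t ≫ t +
      t ≫ t ≫ t ≫ t ≫ t ≫ t = 0) :
    t ≫ t ≫ t ≫ t ≫ t ≫ t ≫ t = 𝟙 X := by
  have h' := congrArg (fun f => t ≫ f) h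
  simp only [Preadditive.comp_add, Category.comp_id, Limits.comp_zero] at h'
  have e : t ≫ t ≫ t ≫ t ≫ t ≫ t ≫ t =
      (t + t ≫ t + t ≫ t ≫ t + t ≫ t ≫ t ≫ t + t ≫ t ≫ t ≫ t ≫ t + t ≫ t ≫ t ≫ t ≫ t ≫ t +
        t ≫ t ≫ t ≫ t ≫ t ≫ t ≫ t) -
      (𝟙 X + t + t ≫ t + t ≫ t ≫ t + t ≫ t ≫ t ≫ t + t ≫ t ≫ t ≫ t ≫ t +
        t ≫ t ≫ t ≫ t ≫ t ≫ t) + 𝟙 X := by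
    abel
  rw [e, h, h', sub_zero, zero_add]

/-- **The quadratic Gauss sum: `η² = -7`.**  If `Φ₇(t) = 0` (so `t` acts through primitive 7th roots
of unity), then `η := t + t² + t⁴ - t³ - t⁵ - t⁶ = Σ_{a ∈ (ℤ/7)ˣ} (a/7)·tᵃ` satisfies
`η ∘ η = -7`: the order `ℤ[η] ≅ ℤ[√-7]` of the imaginary quadratic subfield `ℚ(√-7) ⊂ ℚ(μ₇)`
acts (even `(𝟙 + η)/2 = -(t³ + t⁵ + t⁶)` does: `ℤ[(1+√-7)/2] ⊂ ℤ[ζ₇]`) — Schoen 1988, §3, p. 24,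
the multiplication "from `K = ℚ(μ_m)`" on `B`; Patel–Zhang 2025, §5.1: `End_ℚ(B_prim) ⊇ ℚ(μ_m)`.
In the group ring: `η² = -6·𝟙 + (t + ⋯ + t⁶) = -7·𝟙 + Φ₇(t)`. [cite: Schoen1988HodgeWeil, §3 (p. 24)] -/
theorem weilOperator_comp_self_of_cyclotomic₇
    (h : 𝟙 X + t + t ≫ t + t ≫ t ≫ t + t ≫ t ≫ t ≫ t + t ≫ t ≫ t ≫ t ≫ t +
      t ≫ t ≫ t ≫ t ≫ t ≫ t = 0) {η : X ⟶ X}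
    (hη : η = t + t ≫ t + t ≫ t ≫ t ≫ t - t ≫ t ≫ t - t ≫ t ≫ t ≫ t ≫ t -
      t ≫ t ≫ t ≫ t ≫ t ≫ t) :
    η ≫ η = -((7 : ℤ) • 𝟙 X) := by
  have h7 := comp_pow_seven_eq_id_of_cyclotomic₇ h
  have h6 := eq_neg_of_add_eq_zero_right h
  subst hη
  -- expand the 36 products, reduce the exponents modulo `t⁷ = 𝟙`, eliminate `t⁶` by `Φ₇(t) = 0`
  simp only [Preadditive.add_comp, Preadditive.comp_add, Preadditive.sub_comp, Preadditive.comp_sub,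
    Category.assoc, Category.comp_id, h7]
  rw [h6]
  abel

/-- The same identity with the sign inside the scalar: `η ∘ η = (-7)·𝟙`. [folklore] -/
theorem weilOperator_comp_self_of_cyclotomic₇'
    (h : 𝟙 X + t + t ≫ t + t ≫ t ≫ t + t ≫ t ≫ t ≫ t + t ≫ t ≫ t ≫ t ≫ t +
      t ≫ t ≫ t ≫ t ≫ t ≫ t = 0) {η : X ⟶ X}
    (hη : η = t + t ≫ t + t ≫ t ≫ t ≫ t - t ≫ t ≫ t - t ≫ t ≫ t ≫ t ≫ t -
      t ≫ t ≫ t ≫ t ≫ t ≫ t) :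
    η ≫ η = (-7 : ℤ) • 𝟙 X := by
  rw [weilOperator_comp_self_of_cyclotomic₇ h hη, neg_smul]

/-- `η = t + t² + t⁴ - t³ - t⁵ - t⁶` commutes with `t`. [folklore] -/
theorem weilOperator_comm_of_cyclotomic₇ {η : X ⟶ X}
    (hη : η = t + t ≫ t + t ≫ t ≫ t ≫ t - t ≫ t ≫ t - t ≫ t ≫ t ≫ t ≫ t -
      t ≫ t ≫ t ≫ t ≫ t ≫ t) :
    t ≫ η = η ≫ t := by
  subst hη
  simp only [Preadditive.add_comp, Preadditive.comp_add, Preadditive.sub_comp, Preadditive.comp_sub,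
    Category.assoc]

/-- **The norm element is `t`-invariant**: if `t⁷ = 𝟙` then `t ∘ e = e` for `e = 𝟙 + t + ⋯ + t⁶`
(`= π^* ∘ Nm` for `t = σ_*` of a cyclic cover of degree `7`). [folklore] -/
theorem comp_normElement_eq_of_comp_pow_seven (h7 : t ≫ t ≫ t ≫ t ≫ t ≫ t ≫ t = 𝟙 X) {e : X ⟶ X}
    (he : e = 𝟙 X + t + t ≫ t + t ≫ t ≫ t + t ≫ t ≫ t ≫ t + t ≫ t ≫ t ≫ t ≫ t +
      t ≫ t ≫ t ≫ t ≫ t ≫ t) :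
    t ≫ e = e := by
  subst he
  simp only [Preadditive.comp_add, Category.comp_id, h7]
  abel

/-- Likewise `e ∘ t = e`. [folklore] -/
theorem normElement_comp_eq_of_comp_pow_seven (h7 : t ≫ t ≫ t ≫ t ≫ t ≫ t ≫ t = 𝟙 X) {e : X ⟶ X}
    (he : e = 𝟙 X + t + t ≫ t + t ≫ t ≫ t + t ≫ t ≫ t ≫ t + t ≫ t ≫ t ≫ t ≫ t +
      t ≫ t ≫ t ≫ t ≫ t ≫ t) :
    e ≫ t = e := by
  subst he
  simp only [Preadditive.add_comp, Category.id_comp, Category.assoc, h7]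
  abel

/-- The norm element commutes with `t` (so `t` restricts to `(ker e)⁰`,
`AbelianVariety.kerComponentRestrict`). [folklore] -/
theorem comp_normElement_comm_of_comp_pow_seven (h7 : t ≫ t ≫ t ≫ t ≫ t ≫ t ≫ t = 𝟙 X)
    {e : X ⟶ X}
    (he : e = 𝟙 X + t + t ≫ t + t ≫ t ≫ t + t ≫ t ≫ t ≫ t + t ≫ t ≫ t ≫ t ≫ t +
      t ≫ t ≫ t ≫ t ≫ t ≫ t) :
    t ≫ e = e ≫ t := by
  rw [comp_normElement_eq_of_comp_pow_seven h7 he, normElement_comp_eq_of_comp_pow_seven h7 he]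

/-- **`Im(𝟙 - t) ⊆ ker e`**: `(𝟙 - t) ∘ e = 0` for `t⁷ = 𝟙` (Patel–Zhang 2025, §5: the Prym is
`Im(1 - σ) = (ker Nm)⁰`). [cite: PatelZhang2025PrymHodge, §5 (eqn. Prym-image)] -/
theorem id_sub_comp_normElement_eq_zero (h7 : t ≫ t ≫ t ≫ t ≫ t ≫ t ≫ t = 𝟙 X) {e : X ⟶ X}
    (he : e = 𝟙 X + t + t ≫ t + t ≫ t ≫ t + t ≫ t ≫ t ≫ t + t ≫ t ≫ t ≫ t ≫ t +
      t ≫ t ≫ t ≫ t ≫ t ≫ t) :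
    (𝟙 X - t) ≫ e = 0 := by
  rw [Preadditive.sub_comp, Category.id_comp, comp_normElement_eq_of_comp_pow_seven h7 he, sub_self]

/-- Likewise `e ∘ (𝟙 - t) = 0`. [folklore] -/
theorem normElement_comp_id_sub_eq_zero (h7 : t ≫ t ≫ t ≫ t ≫ t ≫ t ≫ t = 𝟙 X) {e : X ⟶ X}
    (he : e = 𝟙 X + t + t ≫ t + t ≫ t ≫ t + t ≫ t ≫ t ≫ t + t ≫ t ≫ t ≫ t ≫ t +
      t ≫ t ≫ t ≫ t ≫ t ≫ t) :
    e ≫ (𝟙 X - t) = 0 := by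
  rw [Preadditive.comp_sub, Category.comp_id, normElement_comp_eq_of_comp_pow_seven h7 he, sub_self]

/-- **`e ∘ e = 7e`**: the norm element is `7` times an idempotent of `End⁰` (its image `π^* J(C')`
and `(ker e)⁰` are complementary up to isogeny; Schoen's `P = 7·Id - e`). [folklore] -/
theorem normElement_comp_self (h7 : t ≫ t ≫ t ≫ t ≫ t ≫ t ≫ t = 𝟙 X) {e : X ⟶ X}
    (he : e = 𝟙 X + t + t ≫ t + t ≫ t ≫ t + t ≫ t ≫ t ≫ t + t ≫ t ≫ t ≫ t ≫ t +
      t ≫ t ≫ t ≫ t ≫ t ≫ t) :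
    e ≫ e = 7 • e := by
  have ht := comp_normElement_eq_of_comp_pow_seven h7 he
  calc e ≫ e = (𝟙 X + t + t ≫ t + t ≫ t ≫ t + t ≫ t ≫ t ≫ t + t ≫ t ≫ t ≫ t ≫ t +
      t ≫ t ≫ t ≫ t ≫ t ≫ t) ≫ e := by rw [← he]
    _ = 7 • e := by
      simp only [Preadditive.add_comp, Category.id_comp, Category.assoc, ht]
      abel

end CyclotomicSeven

/-! ### Dictionary lemma: an automorphism of prime order `7` without fixed points acts freely -/

section FreeAction

variable {𝒞 : Type*} [Category 𝒞] {Q C : 𝒞} {σ : C ⟶ C} {P : Q ⟶ C}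

/-- **Prime order: `⟨σⁱ⟩ = ⟨σ⟩`.**  If `σ⁷ = 𝟙` and the point `P` is not fixed by `σ`, then it is
fixed by no `σⁱ`, `1 ≤ i ≤ 6` (`σ = (σⁱ)ʲ` with `ij ≡ 1 (mod 7)`).  Hence an automorphism of a curve
of order `7` "without fixed points" generates a FREE action of `ℤ/7`: the quotient map is an étale
cyclic cover of degree `7` (`r = 0` in Schoen 1988, Thm. 2.0). [folklore] -/
theorem comp_pow_ne_of_comp_ne_of_pow_seven (hσ : σ ≫ σ ≫ σ ≫ σ ≫ σ ≫ σ ≫ σ = 𝟙 C)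
    (hP : P ≫ σ ≠ P) :
    P ≫ σ ≫ σ ≠ P ∧ P ≫ σ ≫ σ ≫ σ ≠ P ∧ P ≫ σ ≫ σ ≫ σ ≫ σ ≠ P ∧
      P ≫ σ ≫ σ ≫ σ ≫ σ ≫ σ ≠ P ∧ P ≫ σ ≫ σ ≫ σ ≫ σ ≫ σ ≫ σ ≠ P := by
  refine ⟨fun h2 => hP ?_, fun h3 => hP ?_, fun h4 => hP ?_, fun h5 => hP ?_, fun h6 => hP ?_⟩
  · calc P ≫ σ = P ≫ σ ≫ (σ ≫ σ ≫ σ ≫ σ ≫ σ ≫ σ ≫ σ) := by rw [hσ, Category.comp_id]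
      _ = P := by simp only [reassoc_of% h2, h2]
  · calc P ≫ σ = P ≫ σ ≫ (σ ≫ σ ≫ σ ≫ σ ≫ σ ≫ σ ≫ σ) ≫ (σ ≫ σ ≫ σ ≫ σ ≫ σ ≫ σ ≫ σ) := by
          rw [hσ, Category.comp_id, Category.comp_id]
      _ = P := by simp only [Category.assoc, reassoc_of% h3, h3]
  · calc P ≫ σ = P ≫ σ ≫ (σ ≫ σ ≫ σ ≫ σ ≫ σ ≫ σ ≫ σ) := by rw [hσ, Category.comp_id]
      _ = P := by simp only [reassoc_of% h4, h4]
  · calc P ≫ σ = P ≫ σ ≫ (σ ≫ σ ≫ σ ≫ σ ≫ σ ≫ σ ≫ σ) ≫ (σ ≫ σ ≫ σ ≫ σ ≫ σ ≫ σ ≫ σ) := by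
          rw [hσ, Category.comp_id, Category.comp_id]
      _ = P := by simp only [Category.assoc, reassoc_of% h5, h5]
  · calc P ≫ σ = (P ≫ σ ≫ σ ≫ σ ≫ σ ≫ σ ≫ σ) ≫ σ := by rw [h6]
      _ = P := by simp only [Category.assoc, hσ, Category.comp_id]

/-- The same for the complex points of a `ℂ`-scheme, in the binder shape of
`Schoen1988_cyclicPrym_weilClasses_algebraic_degreeSeven`: `σ⁷ = 𝟙_C` and
`∀ P : C(ℂ), σ(P) ≠ P` give `σⁱ(P) ≠ P` for all `P` and `1 ≤ i ≤ 6` — the cover `C → C/⟨σ⟩` is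
étale. [folklore] -/
theorem complexPoints_comp_pow_ne_of_pow_seven {C : SchemeOver ℂ} {σ : C ⟶ C}
    (hσ : σ ≫ σ ≫ σ ≫ σ ≫ σ ≫ σ ≫ σ = 𝟙 C) (hfree : ∀ P : ComplexPoints C, P ≫ σ ≠ P)
    (P : ComplexPoints C) :
    P ≫ σ ≫ σ ≠ P ∧ P ≫ σ ≫ σ ≫ σ ≠ P ∧ P ≫ σ ≫ σ ≫ σ ≫ σ ≠ P ∧
      P ≫ σ ≫ σ ≫ σ ≫ σ ≫ σ ≠ P ∧ P ≫ σ ≫ σ ≫ σ ≫ σ ≫ σ ≫ σ ≠ P :=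
  comp_pow_ne_of_comp_ne_of_pow_seven hσ (hfree P)

end FreeAction

/-! ### Dictionary lemmas: `s_B`, `η_B` on the Prym `B = (ker e_N)⁰` and `s = σ_*` on `J(C)` -/

section PrymSeven

variable {J : AbelianVariety ℂ} {s eN : J ⟶ J}

/-- **`Φ₇(s_B) = 0` on `B = (ker e_N)⁰`, `e_N = Σ_{i<7} sⁱ`.**  A restriction `s_B` of `s` to the
identity component of `ker e_N` (`s_B ≫ ι = ι ≫ s`; it exists, `AbelianVariety.kerComponentRestrict`,
by `comp_normElement_comm_of_comp_pow_seven`) is killed by `Φ₇`: `(Σ_{i<7} s_Bⁱ)` followed by the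
monomorphism `ι : B ↪ J` is `ι ≫ e_N = 0` (`AbelianVariety.kerComponentι_comp`).  Hence `s_B` acts
on every realisation of `B` through PRIMITIVE 7th roots of unity: `B` is Patel–Zhang's
`J(C)_{nt} = B_prim` (`m = 7` prime) = Schoen's `B` (§3, p. 24).
[cite: PatelZhang2025PrymHodge, §5 (eqn. Prym) and Lemma 5.1] -/
theorem kerComponent_cyclotomic₇_restrict_eq_zero
    (heN : eN = 𝟙 J + s + s ≫ s + s ≫ s ≫ s + s ≫ s ≫ s ≫ s + s ≫ s ≫ s ≫ s ≫ s +
      s ≫ s ≫ s ≫ s ≫ s ≫ s)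
    {sB : AbelianVariety.kerComponent eN ⟶ AbelianVariety.kerComponent eN}
    (hsB : sB ≫ AbelianVariety.kerComponentι eN = AbelianVariety.kerComponentι eN ≫ s) :
    𝟙 _ + sB + sB ≫ sB + sB ≫ sB ≫ sB + sB ≫ sB ≫ sB ≫ sB + sB ≫ sB ≫ sB ≫ sB ≫ sB +
      sB ≫ sB ≫ sB ≫ sB ≫ sB ≫ sB = 0 := by
  have hι : AbelianVariety.kerComponentι eN ≫ (𝟙 J + s + s ≫ s + s ≫ s ≫ s + s ≫ s ≫ s ≫ s +
      s ≫ s ≫ s ≫ s ≫ s + s ≫ s ≫ s ≫ s ≫ s ≫ s) = 0 := by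
    rw [← heN]
    exact AbelianVariety.kerComponentι_comp eN
  have hsB' : ∀ {Z : AbelianVariety ℂ} (f : J ⟶ Z),
      sB ≫ AbelianVariety.kerComponentι eN ≫ f = AbelianVariety.kerComponentι eN ≫ s ≫ f :=
    fun f => by rw [← Category.assoc, hsB, Category.assoc]
  rw [← cancel_mono (AbelianVariety.kerComponentι eN), Limits.zero_comp, ← hι]
  simp only [Preadditive.add_comp, Preadditive.comp_add, Category.id_comp, Category.comp_id,
    Category.assoc, hsB, hsB']

/-- `s_B⁷ = 𝟙_B`: `⟨s_B⟩` is an action of `ℤ/7` on `B = (ker e_N)⁰`. [folklore] -/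
theorem kerComponent_restrict_comp_pow_seven
    (heN : eN = 𝟙 J + s + s ≫ s + s ≫ s ≫ s + s ≫ s ≫ s ≫ s + s ≫ s ≫ s ≫ s ≫ s +
      s ≫ s ≫ s ≫ s ≫ s ≫ s)
    {sB : AbelianVariety.kerComponent eN ⟶ AbelianVariety.kerComponent eN}
    (hsB : sB ≫ AbelianVariety.kerComponentι eN = AbelianVariety.kerComponentι eN ≫ s) :
    sB ≫ sB ≫ sB ≫ sB ≫ sB ≫ sB ≫ sB = 𝟙 _ :=
  comp_pow_seven_eq_id_of_cyclotomic₇ (kerComponent_cyclotomic₇_restrict_eq_zero heN hsB)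

/-- **`η_B² = -7` on `B = (ker e_N)⁰`** for the Gauss sum
`η_B = s_B + s_B² + s_B⁴ - s_B³ - s_B⁵ - s_B⁶`, in the binder shape of
`Schoen1988_cyclicPrym_weilClasses_algebraic_degreeSeven`: `B` carries multiplication by
`ℤ[η_B] = ℤ[√-7] ⊂ ℤ[ζ₇]` commuting with `s_B` (Schoen 1988, §3, p. 24; it is this `√-7` that
the Hecke–Prym twelvefold of an `F₂₁`-cover inherits). [cite: Schoen1988HodgeWeil, §3 (p. 24)] -/
theorem kerComponent_weilOperator_comp_self_of_cyclotomic₇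
    (heN : eN = 𝟙 J + s + s ≫ s + s ≫ s ≫ s + s ≫ s ≫ s ≫ s + s ≫ s ≫ s ≫ s ≫ s +
      s ≫ s ≫ s ≫ s ≫ s ≫ s)
    {sB η : AbelianVariety.kerComponent eN ⟶ AbelianVariety.kerComponent eN}
    (hsB : sB ≫ AbelianVariety.kerComponentι eN = AbelianVariety.kerComponentι eN ≫ s)
    (hη : η = sB + sB ≫ sB + sB ≫ sB ≫ sB ≫ sB - sB ≫ sB ≫ sB - sB ≫ sB ≫ sB ≫ sB ≫ sB -
      sB ≫ sB ≫ sB ≫ sB ≫ sB ≫ sB) :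
    η ≫ η = -((7 : ℤ) • 𝟙 _) :=
  weilOperator_comp_self_of_cyclotomic₇ (kerComponent_cyclotomic₇_restrict_eq_zero heN hsB) hη

/-- **`(σ_*)⁷ = 𝟙_{J(C)}` for `σ⁷ = 𝟙_C`**: Albanese functoriality of the norm map
(`Jacobian.pushforward_comp`, `Jacobian.pushforward_id`; Lange 2023, §4.5.2), in the binder shape of
`Schoen1988_cyclicPrym_weilClasses_algebraic_degreeSeven`. [cite: Lange2023AbelianVarietiesC, §4.5.2] -/
theorem pushforward_comp_pow_seven_of_pow_seven {C : SchemeOver ℂ} (𝒥 : Jacobian C) {σ : C ⟶ C}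
    (hσ : σ ≫ σ ≫ σ ≫ σ ≫ σ ≫ σ ≫ σ = 𝟙 C) {s : 𝒥.J ⟶ 𝒥.J} (hs : s = 𝒥.pushforward 𝒥 σ) :
    s ≫ s ≫ s ≫ s ≫ s ≫ s ≫ s = 𝟙 𝒥.J := by
  subst hs
  simp only [← Jacobian.pushforward_comp, hσ, Jacobian.pushforward_id]

/-- **On `J(C)`: `σ_* ∘ e_N = e_N ∘ σ_*`, `(𝟙 - σ_*) ∘ e_N = 0`, `e_N² = 7 e_N`** for `σ⁷ = 𝟙_C` and
`e_N = Σ_{i<7} σ_*ⁱ` (`= π^* ∘ Nm_π`), in the binder shape of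
`Schoen1988_cyclicPrym_weilClasses_algebraic_degreeSeven`: `s` restricts to `B = (ker e_N)⁰`
(`AbelianVariety.kerComponentRestrict e_N s s`), and `Im(𝟙 - s) ⊆ ker e_N`. [folklore] -/
theorem pushforward_normElement {C : SchemeOver ℂ} (𝒥 : Jacobian C) {σ : C ⟶ C}
    (hσ : σ ≫ σ ≫ σ ≫ σ ≫ σ ≫ σ ≫ σ = 𝟙 C) {s eN : 𝒥.J ⟶ 𝒥.J} (hs : s = 𝒥.pushforward 𝒥 σ)
    (heN : eN = 𝟙 𝒥.J + s + s ≫ s + s ≫ s ≫ s + s ≫ s ≫ s ≫ s + s ≫ s ≫ s ≫ s ≫ s +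
      s ≫ s ≫ s ≫ s ≫ s ≫ s) :
    s ≫ eN = eN ≫ s ∧ (𝟙 𝒥.J - s) ≫ eN = 0 ∧ eN ≫ eN = 7 • eN :=
  ⟨comp_normElement_comm_of_comp_pow_seven (pushforward_comp_pow_seven_of_pow_seven 𝒥 hσ hs) heN,
    id_sub_comp_normElement_eq_zero (pushforward_comp_pow_seven_of_pow_seven 𝒥 hσ hs) heN,
    normElement_comp_self (pushforward_comp_pow_seven_of_pow_seven 𝒥 hσ hs) heN⟩

/-- **The restriction `s_B` exists** (the binder `sB` of the fact is instantiable): for `σ⁷ = 𝟙_C`,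
`s = σ_*` commutes with `e_N`, so `AbelianVariety.kerComponentRestrict e_N s s _` is an endomorphism
of `B = (ker e_N)⁰` over `s`. [folklore] -/
theorem exists_kerComponent_restrict_pushforward {C : SchemeOver ℂ} (𝒥 : Jacobian C) {σ : C ⟶ C}
    (hσ : σ ≫ σ ≫ σ ≫ σ ≫ σ ≫ σ ≫ σ = 𝟙 C) {s eN : 𝒥.J ⟶ 𝒥.J} (hs : s = 𝒥.pushforward 𝒥 σ)
    (heN : eN = 𝟙 𝒥.J + s + s ≫ s + s ≫ s ≫ s + s ≫ s ≫ s ≫ s + s ≫ s ≫ s ≫ s ≫ s +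
      s ≫ s ≫ s ≫ s ≫ s ≫ s) :
    ∃ sB : AbelianVariety.kerComponent eN ⟶ AbelianVariety.kerComponent eN,
      sB ≫ AbelianVariety.kerComponentι eN = AbelianVariety.kerComponentι eN ≫ s :=
  ⟨AbelianVariety.kerComponentRestrict eN s s (pushforward_normElement 𝒥 hσ hs heN).1,
    AbelianVariety.kerComponentRestrict_ι eN s s _⟩

end PrymSeven

end Literature.AlgebraicGeometry.HodgeTheory
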